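import Mathlib
import Summits.PneNP.PneNP.Theorems.OverlapGapAlgebraSolvableImpliesStableSectionMonotoneRepairBadCount
import Summits.PneNP.PneNP.Theorems.OverlapGapAlgebraSolvableImpliesStableSectionMonotoneRepairTreeCount
import Summits.PneNP.PneNP.Theorems.OverlapGapAlgebraSolvableImpliesStableSectionMonotoneRepairWeightBound
import Summits.PneNP.PneNP.Theorems.OverlapGapAlgebraSolvableImpliesStableSectionMonotoneRepairBuild
import Summits.PneNP.PneNP.Theorems.OverlapGapAlgebraSolvableImpliesStableSectionMonotoneRepairInjOrBad

/-!
# PneNP / OverlapGapAlgebra — crux `SolvableImpliesStableSection` (stmt-PneNP-2463):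
# the MONOTONE REPAIR block (16/·) — the first moment of the violated clauses

Support for crux `stmt-PneNP-2463` (`Summit.PneNP.PneNP.Theses.OverlapGapAlgebra.SolvableImpliesStableSection`):
the f-free block "bounded-round monotone repair gives stable sections up to `α ≤ 2^k/(4k)`".
Assembly of the counting argument at fixed `n, m, k` with `4k·m ≤ 2^k·n` and `L ≥ 1` rounds: a
clause violated after `L` rounds of monotone repair is the root of a syntactically and locally valid
witness tree of `TS L` (`sissR_rootBuild`); if the tree is injective it is realised by exactly
`#Inst · wt(T)` instances (`sissR_treeCount`) and the total weight of such trees is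
`≤ m·2^{-k}·(2^{-L} + (2m/(2^k n))^k)` (`sissR_weight_root`); otherwise the clause starts a bad walk of
length `≤ 2L` (`sissR_injOrBad`), and bad walks are rare (`…MonotoneRepairBadCount`).

* `sissR_card_viol_le` — per instance: `#violated ≤ #{roots of valid injective trees} + #bad starts`;
* `sissR_count_eq_wt` — `#{Φ : T valid in Φ} = #Inst · wt(T)` for the injective trees;
* `sissR_sum_card_violated_le` — **the mean bound**:
  `∑_Φ #violated(Φ) ≤ #Inst·(m·2^{-k}(2^{-L} + (2m/(2^k n))^k) + ∑_{ℓ ≤ 2L} m^{ℓ+1} k^{2ℓ+3}(ℓ+1)/n^{ℓ+1})`.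
No definitions (all objects are hypotheses); axioms `propext`, `Classical.choice`, `Quot.sound`.
-/

set_option linter.dupNamespace false -- `Summit.PneNP.PneNP.…`: summit = sub-problem (D-0017)

namespace Summit.PneNP.PneNP.Theorems

open Finset
open scoped Classical

section Mean

variable {m k n : ℕ}

/-- **Per instance: violated clauses are roots of valid injective trees or starts of bad walks.** -/
theorem sissR_card_viol_le (asm : Fin m → ℕ → (Fin k → Option (Finset (List (Fin k) × (Fin m × ℕ)))) → Finset (List (Fin k) × (Fin m × ℕ)))
    (hasm : ∀ (c : Fin m) (r : ℕ) (ch : Fin k → Option (Finset (List (Fin k) × (Fin m × ℕ))))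
      (e : (List (Fin k) × (Fin m × ℕ))), e ∈ asm c r ch ↔ (e = ([], (c, r)) ∨
      ∃ (j : Fin k) (S : Finset (List (Fin k) × (Fin m × ℕ))), ch j = some S ∧
        ∃ b : List (Fin k), (b, e.2) ∈ S ∧ e.1 = b ++ [j]))
    (TS : ℕ → Finset (Finset (List (Fin k) × (Fin m × ℕ)))) (L : ℕ)
    (hTS0 : ∀ T : Finset (List (Fin k) × (Fin m × ℕ)), T ∈ TS 0 ↔
      ∃ (c : Fin m) (r : ℕ), r ≤ L ∧ T = asm c r (fun _ => none))
    (hTSs : ∀ (d : ℕ) (T : Finset (List (Fin k) × (Fin m × ℕ))), T ∈ TS (d + 1) ↔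
      ∃ (c : Fin m) (r : ℕ), r ≤ L ∧ ∃ ch : Fin k → Option (Finset (List (Fin k) × (Fin m × ℕ))),
        (∀ (j : Fin k) (S : Finset (List (Fin k) × (Fin m × ℕ))), ch j = some S → S ∈ TS d) ∧ T = asm c r ch)
    (val : ℕ → (Fin m → Fin k → Fin n × Bool) → Fin n → Bool)
    (hval0 : ∀ (Φ : (Fin m → Fin k → Fin n × Bool)) (v : Fin n), val 0 Φ v = true)
    (hvalS : ∀ (t : ℕ) (Φ : (Fin m → Fin k → Fin n × Bool)) (v : Fin n), val (t + 1) Φ v = true ↔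
      (val t Φ v = true ∧ ¬ (∃ ii : Fin m, (∀ jj : Fin k, val t Φ (Φ ii jj).1 ≠ (Φ ii jj).2) ∧
        ∃ jf : Fin k, (Φ ii jf).2 = false ∧ (∀ j' : Fin k, j' < jf → (Φ ii j').2 = true) ∧ (Φ ii jf).1 = v)))
    (hk : 1 ≤ k) (Φ : (Fin m → Fin k → Fin n × Bool)) :
    (((univ : Finset (Fin m)).filter fun c => (∀ jj : Fin k, val L Φ (Φ c jj).1 ≠ (Φ c jj).2)).card : ℝ)
      ≤ ∑ T ∈ (TS L).filter (fun T => ((∀ e ∈ T, ∀ (j : Fin k) (y : Fin m) (s : ℕ), (j :: e.1, (y, s)) ∈ T →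
        s < e.2.2 ∧ ∃ j' : Fin k, ∀ lab : Fin m × ℕ, (j' :: j :: e.1, lab) ∉ T) ∧
      (∀ e ∈ T, 1 ≤ e.2.2 → (∃ (j : Fin k) (y : Fin m), (j :: e.1, (y, e.2.2 - 1)) ∈ T) ∨
        (e.1 = [] ∧ ∀ j : Fin k, ∃ lab : Fin m × ℕ, ([j], lab) ∈ T))) ∧ (∀ e ∈ T, ∀ e' ∈ T, e.2.1 = e'.2.1 → e.1 = e'.1) ∧
            ∃ y : Fin m, (([] : List (Fin k)), (y, L)) ∈ T),
          (if (∀ e ∈ T, ∀ j : Fin k,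
      (((Φ e.2.1 j).2 = true ↔ ∃ lab : Fin m × ℕ, (j :: e.1, lab) ∈ T) ∧
      ∀ (y : Fin m) (s : ℕ), (j :: e.1, (y, s)) ∈ T → ∃ j' : Fin k,
        (∀ lab : Fin m × ℕ, (j' :: j :: e.1, lab) ∉ T) ∧
        (∀ j'' : Fin k, j'' < j' → ∃ lab : Fin m × ℕ, (j'' :: j :: e.1, lab) ∈ T) ∧
        (Φ e.2.1 j).1 = (Φ y j').1)) then (1 : ℝ) else 0) +
        ∑ Lw ∈ Finset.range (2 * L + 1),
          (((univ : Finset (Fin m)).filter fun c => (∃ (w : ℕ → Fin m) (u o : ℕ → Fin k) (a : ℕ) (j : Fin k),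
        w 0 = c ∧ a ≤ Lw ∧ (∀ a' b', a' ≤ Lw → b' ≤ Lw → w a' = w b' → a' = b') ∧
        (∀ d, d < Lw → (Φ (w (d + 1)) (u (d + 1))).1 = (Φ (w d) (o d)).1) ∧
        (Lw = 0 ∨ o Lw ≠ u Lw) ∧ (a < Lw ∨ j ≠ o Lw) ∧ (Φ (w Lw) (o Lw)).1 = (Φ (w a) j).1)).card : ℝ) := by
  set G : Finset (Finset (List (Fin k) × (Fin m × ℕ))) := (TS L).filter (fun T => ((∀ e ∈ T, ∀ (j : Fin k) (y : Fin m) (s : ℕ), (j :: e.1, (y, s)) ∈ T →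
        s < e.2.2 ∧ ∃ j' : Fin k, ∀ lab : Fin m × ℕ, (j' :: j :: e.1, lab) ∉ T) ∧
      (∀ e ∈ T, 1 ≤ e.2.2 → (∃ (j : Fin k) (y : Fin m), (j :: e.1, (y, e.2.2 - 1)) ∈ T) ∨
        (e.1 = [] ∧ ∀ j : Fin k, ∃ lab : Fin m × ℕ, ([j], lab) ∈ T))) ∧ (∀ e ∈ T, ∀ e' ∈ T, e.2.1 = e'.2.1 → e.1 = e'.1) ∧
      ∃ y : Fin m, (([] : List (Fin k)), (y, L)) ∈ T) with hG
  -- the cover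
  have hcover : ((univ : Finset (Fin m)).filter fun c => (∀ jj : Fin k, val L Φ (Φ c jj).1 ≠ (Φ c jj).2)) ⊆
      G.biUnion (fun T => (univ : Finset (Fin m)).filter fun c =>
          (([] : List (Fin k)), (c, L)) ∈ T ∧ (∀ e ∈ T, ∀ j : Fin k,
      (((Φ e.2.1 j).2 = true ↔ ∃ lab : Fin m × ℕ, (j :: e.1, lab) ∈ T) ∧
      ∀ (y : Fin m) (s : ℕ), (j :: e.1, (y, s)) ∈ T → ∃ j' : Fin k,
        (∀ lab : Fin m × ℕ, (j' :: j :: e.1, lab) ∉ T) ∧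
        (∀ j'' : Fin k, j'' < j' → ∃ lab : Fin m × ℕ, (j'' :: j :: e.1, lab) ∈ T) ∧
        (Φ e.2.1 j).1 = (Φ y j').1))) ∪
      (Finset.range (2 * L + 1)).biUnion (fun Lw => (univ : Finset (Fin m)).filter fun c =>
          (∃ (w : ℕ → Fin m) (u o : ℕ → Fin k) (a : ℕ) (j : Fin k),
        w 0 = c ∧ a ≤ Lw ∧ (∀ a' b', a' ≤ Lw → b' ≤ Lw → w a' = w b' → a' = b') ∧
        (∀ d, d < Lw → (Φ (w (d + 1)) (u (d + 1))).1 = (Φ (w d) (o d)).1) ∧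
        (Lw = 0 ∨ o Lw ≠ u Lw) ∧ (a < Lw ∨ j ≠ o Lw) ∧ (Φ (w Lw) (o Lw)).1 = (Φ (w a) j).1)) := by
    intro c hc
    rw [Finset.mem_filter] at hc
    obtain ⟨T, hT, hroot, hsyn, hloc⟩ := sissR_rootBuild asm hasm TS L hTS0 hTSs val hval0 hvalS hk Φ c hc.2
    rw [Finset.mem_union]
    by_cases hinj : ∀ e ∈ T, ∀ e' ∈ T, e.2.1 = e'.2.1 → e.1 = e'.1
    · left
      rw [Finset.mem_biUnion]
      refine ⟨T, ?_, ?_⟩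
      · rw [hG, Finset.mem_filter]; exact ⟨hT, hloc, hinj, c, hroot⟩
      · rw [Finset.mem_filter]; exact ⟨mem_univ _, hroot, hsyn⟩
    · right
      obtain ⟨⟨_, _, _, _⟩, hfun, hpar, hlen⟩ := sissR_TS_valid asm hasm TS L hTS0 hTSs L T hT
      obtain ⟨Lw, hLw, hbad⟩ := sissR_injOrBad T Φ hfun hpar hsyn c L hroot ⟨0, hk⟩ L
        (fun e he => (hlen e he).1) hinj
      rw [Finset.mem_biUnion]
      exact ⟨Lw, Finset.mem_range.2 (by omega), by rw [Finset.mem_filter]; exact ⟨mem_univ _, hbad⟩⟩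
  -- at most one root per tree
  have hone : ∀ T ∈ G, ((((univ : Finset (Fin m)).filter fun c =>
      (([] : List (Fin k)), (c, L)) ∈ T ∧ (∀ e ∈ T, ∀ j : Fin k,
      (((Φ e.2.1 j).2 = true ↔ ∃ lab : Fin m × ℕ, (j :: e.1, lab) ∈ T) ∧
      ∀ (y : Fin m) (s : ℕ), (j :: e.1, (y, s)) ∈ T → ∃ j' : Fin k,
        (∀ lab : Fin m × ℕ, (j' :: j :: e.1, lab) ∉ T) ∧
        (∀ j'' : Fin k, j'' < j' → ∃ lab : Fin m × ℕ, (j'' :: j :: e.1, lab) ∈ T) ∧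
        (Φ e.2.1 j).1 = (Φ y j').1))).card : ℕ) : ℝ)
        ≤ (if (∀ e ∈ T, ∀ j : Fin k,
      (((Φ e.2.1 j).2 = true ↔ ∃ lab : Fin m × ℕ, (j :: e.1, lab) ∈ T) ∧
      ∀ (y : Fin m) (s : ℕ), (j :: e.1, (y, s)) ∈ T → ∃ j' : Fin k,
        (∀ lab : Fin m × ℕ, (j' :: j :: e.1, lab) ∉ T) ∧
        (∀ j'' : Fin k, j'' < j' → ∃ lab : Fin m × ℕ, (j'' :: j :: e.1, lab) ∈ T) ∧
        (Φ e.2.1 j).1 = (Φ y j').1)) then (1 : ℝ) else 0) := by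
    intro T hT
    rw [hG, Finset.mem_filter] at hT
    obtain ⟨_, hfun, _⟩ := sissR_TS_valid asm hasm TS L hTS0 hTSs L T hT.1
    split_ifs with hs
    · have : (((univ : Finset (Fin m)).filter fun c =>
          (([] : List (Fin k)), (c, L)) ∈ T ∧ (∀ e ∈ T, ∀ j : Fin k,
      (((Φ e.2.1 j).2 = true ↔ ∃ lab : Fin m × ℕ, (j :: e.1, lab) ∈ T) ∧
      ∀ (y : Fin m) (s : ℕ), (j :: e.1, (y, s)) ∈ T → ∃ j' : Fin k,
        (∀ lab : Fin m × ℕ, (j' :: j :: e.1, lab) ∉ T) ∧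
        (∀ j'' : Fin k, j'' < j' → ∃ lab : Fin m × ℕ, (j'' :: j :: e.1, lab) ∈ T) ∧
        (Φ e.2.1 j).1 = (Φ y j').1))).card : ℕ) ≤ 1 := by
        rw [Finset.card_le_one]
        intro c hc c' hc'
        rw [Finset.mem_filter] at hc hc'
        exact (Prod.mk.inj (hfun [] (c, L) (c', L) hc.2.1 hc'.2.1)).1
      exact_mod_cast this
    · rw [Finset.filter_eq_empty_iff.2 fun c _ h => hs h.2, Finset.card_empty]
      simp
  calc ((((univ : Finset (Fin m)).filter fun c => (∀ jj : Fin k, val L Φ (Φ c jj).1 ≠ (Φ c jj).2)).card : ℕ) : ℝ)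
      ≤ (((G.biUnion (fun T => (univ : Finset (Fin m)).filter fun c =>
          (([] : List (Fin k)), (c, L)) ∈ T ∧ (∀ e ∈ T, ∀ j : Fin k,
      (((Φ e.2.1 j).2 = true ↔ ∃ lab : Fin m × ℕ, (j :: e.1, lab) ∈ T) ∧
      ∀ (y : Fin m) (s : ℕ), (j :: e.1, (y, s)) ∈ T → ∃ j' : Fin k,
        (∀ lab : Fin m × ℕ, (j' :: j :: e.1, lab) ∉ T) ∧
        (∀ j'' : Fin k, j'' < j' → ∃ lab : Fin m × ℕ, (j'' :: j :: e.1, lab) ∈ T) ∧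
        (Φ e.2.1 j).1 = (Φ y j').1)))).card : ℕ) : ℝ) +
        ((((Finset.range (2 * L + 1)).biUnion (fun Lw => (univ : Finset (Fin m)).filter fun c =>
          (∃ (w : ℕ → Fin m) (u o : ℕ → Fin k) (a : ℕ) (j : Fin k),
        w 0 = c ∧ a ≤ Lw ∧ (∀ a' b', a' ≤ Lw → b' ≤ Lw → w a' = w b' → a' = b') ∧
        (∀ d, d < Lw → (Φ (w (d + 1)) (u (d + 1))).1 = (Φ (w d) (o d)).1) ∧
        (Lw = 0 ∨ o Lw ≠ u Lw) ∧ (a < Lw ∨ j ≠ o Lw) ∧ (Φ (w Lw) (o Lw)).1 = (Φ (w a) j).1))).card : ℕ) : ℝ) := by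
        exact_mod_cast (Finset.card_le_card hcover).trans (Finset.card_union_le _ _)
    _ ≤ (∑ T ∈ G, ((((univ : Finset (Fin m)).filter fun c =>
          (([] : List (Fin k)), (c, L)) ∈ T ∧ (∀ e ∈ T, ∀ j : Fin k,
      (((Φ e.2.1 j).2 = true ↔ ∃ lab : Fin m × ℕ, (j :: e.1, lab) ∈ T) ∧
      ∀ (y : Fin m) (s : ℕ), (j :: e.1, (y, s)) ∈ T → ∃ j' : Fin k,
        (∀ lab : Fin m × ℕ, (j' :: j :: e.1, lab) ∉ T) ∧
        (∀ j'' : Fin k, j'' < j' → ∃ lab : Fin m × ℕ, (j'' :: j :: e.1, lab) ∈ T) ∧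
        (Φ e.2.1 j).1 = (Φ y j').1))).card : ℕ) : ℝ)) +
        ∑ Lw ∈ Finset.range (2 * L + 1),
          ((((univ : Finset (Fin m)).filter fun c => (∃ (w : ℕ → Fin m) (u o : ℕ → Fin k) (a : ℕ) (j : Fin k),
        w 0 = c ∧ a ≤ Lw ∧ (∀ a' b', a' ≤ Lw → b' ≤ Lw → w a' = w b' → a' = b') ∧
        (∀ d, d < Lw → (Φ (w (d + 1)) (u (d + 1))).1 = (Φ (w d) (o d)).1) ∧
        (Lw = 0 ∨ o Lw ≠ u Lw) ∧ (a < Lw ∨ j ≠ o Lw) ∧ (Φ (w Lw) (o Lw)).1 = (Φ (w a) j).1)).card : ℕ) : ℝ) := by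
        gcongr
        · exact_mod_cast Finset.card_biUnion_le
        · exact_mod_cast Finset.card_biUnion_le
    _ ≤ _ := by
        gcongr with T hT
        exact hone T hT

/-- **The instances realising an injective witness tree number `#Inst · wt(T)`.** -/
theorem sissR_count_eq_wt (asm : Fin m → ℕ → (Fin k → Option (Finset (List (Fin k) × (Fin m × ℕ)))) → Finset (List (Fin k) × (Fin m × ℕ)))
    (hasm : ∀ (c : Fin m) (r : ℕ) (ch : Fin k → Option (Finset (List (Fin k) × (Fin m × ℕ))))
      (e : (List (Fin k) × (Fin m × ℕ))), e ∈ asm c r ch ↔ (e = ([], (c, r)) ∨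
      ∃ (j : Fin k) (S : Finset (List (Fin k) × (Fin m × ℕ))), ch j = some S ∧
        ∃ b : List (Fin k), (b, e.2) ∈ S ∧ e.1 = b ++ [j]))
    (TS : ℕ → Finset (Finset (List (Fin k) × (Fin m × ℕ)))) (L : ℕ)
    (hTS0 : ∀ T : Finset (List (Fin k) × (Fin m × ℕ)), T ∈ TS 0 ↔
      ∃ (c : Fin m) (r : ℕ), r ≤ L ∧ T = asm c r (fun _ => none))
    (hTSs : ∀ (d : ℕ) (T : Finset (List (Fin k) × (Fin m × ℕ))), T ∈ TS (d + 1) ↔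
      ∃ (c : Fin m) (r : ℕ), r ≤ L ∧ ∃ ch : Fin k → Option (Finset (List (Fin k) × (Fin m × ℕ))),
        (∀ (j : Fin k) (S : Finset (List (Fin k) × (Fin m × ℕ))), ch j = some S → S ∈ TS d) ∧ T = asm c r ch)
    (hn : 1 ≤ n) (d : ℕ) (T : Finset (List (Fin k) × (Fin m × ℕ))) (hT : T ∈ TS d) (hloc : (∀ e ∈ T, ∀ (j : Fin k) (y : Fin m) (s : ℕ), (j :: e.1, (y, s)) ∈ T →
        s < e.2.2 ∧ ∃ j' : Fin k, ∀ lab : Fin m × ℕ, (j' :: j :: e.1, lab) ∉ T) ∧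
      (∀ e ∈ T, 1 ≤ e.2.2 → (∃ (j : Fin k) (y : Fin m), (j :: e.1, (y, e.2.2 - 1)) ∈ T) ∨
        (e.1 = [] ∧ ∀ j : Fin k, ∃ lab : Fin m × ℕ, ([j], lab) ∈ T))) (hinj : ∀ e ∈ T, ∀ e' ∈ T, e.2.1 = e'.2.1 → e.1 = e'.1) :
    ((((univ : Finset (Fin m → Fin k → Fin n × Bool)).filter fun Φ => ∀ e ∈ T, ∀ j : Fin k,
      (((Φ e.2.1 j).2 = true ↔ ∃ lab : Fin m × ℕ, (j :: e.1, lab) ∈ T) ∧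
      ∀ (y : Fin m) (s : ℕ), (j :: e.1, (y, s)) ∈ T → ∃ j' : Fin k,
        (∀ lab : Fin m × ℕ, (j' :: j :: e.1, lab) ∉ T) ∧
        (∀ j'' : Fin k, j'' < j' → ∃ lab : Fin m × ℕ, (j'' :: j :: e.1, lab) ∈ T) ∧
        (Φ e.2.1 j).1 = (Φ y j').1)).card : ℕ) : ℝ)
      = (Fintype.card (Fin m → Fin k → Fin n × Bool) : ℝ) * (∏ e ∈ T, ((1 / 2 : ℝ) ^ k * (if e.1 = [] then (1 : ℝ) else 1 / (n : ℝ)))) := by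
  obtain ⟨_, hfun, hpar, _⟩ := sissR_TS_valid asm hasm TS L hTS0 hTSs d T hT
  have hrootc := sissR_TS_rootCount asm hasm TS L hTS0 hTSs d T hT
  have hcount := sissR_treeCount (n := n) T hfun hpar hrootc
    (fun e he j y s hys => (hloc.1 e he j y s hys).2) hinj
  -- the weight as a closed form
  have hnot : (T.filter fun e : (List (Fin k) × (Fin m × ℕ)) => ¬ (e.1 = [])).card = T.card - 1 := by
    have hsum := Finset.card_filter_add_card_filter_not (s := T) (fun e : (List (Fin k) × (Fin m × ℕ)) => e.1 = [])
    rw [hrootc] at hsum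
    omega
  have hwt : (∏ e ∈ T, ((1 / 2 : ℝ) ^ k * (if e.1 = [] then (1 : ℝ) else 1 / (n : ℝ)))) = ((1 / 2 : ℝ) ^ k) ^ T.card * (1 / (n : ℝ)) ^ (T.card - 1) := by
    rw [Finset.prod_mul_distrib, Finset.prod_const]
    congr 1
    rw [← Finset.prod_filter_mul_prod_filter_not T (fun e : (List (Fin k) × (Fin m × ℕ)) => e.1 = []),
      Finset.prod_congr rfl (fun e he => if_pos (Finset.mem_filter.1 he).2), Finset.prod_const_one,
      one_mul, Finset.prod_congr rfl (fun e he => if_neg (Finset.mem_filter.1 he).2), Finset.prod_const,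
      hnot]
  have hn1 : (n : ℝ) ≠ 0 := by exact_mod_cast (show n ≠ 0 by omega)
  -- abstract the two counts
  generalize hC : ((univ : Finset (Fin m → Fin k → Fin n × Bool)).filter fun Φ => ∀ e ∈ T, ∀ j : Fin k,
      (((Φ e.2.1 j).2 = true ↔ ∃ lab : Fin m × ℕ, (j :: e.1, lab) ∈ T) ∧
      ∀ (y : Fin m) (s : ℕ), (j :: e.1, (y, s)) ∈ T → ∃ j' : Fin k,
        (∀ lab : Fin m × ℕ, (j' :: j :: e.1, lab) ∉ T) ∧
        (∀ j'' : Fin k, j'' < j' → ∃ lab : Fin m × ℕ, (j'' :: j :: e.1, lab) ∈ T) ∧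
        (Φ e.2.1 j).1 = (Φ y j').1)).card = C at hcount ⊢
  generalize hN : Fintype.card (Fin m → Fin k → Fin n × Bool) = N at hcount ⊢
  have hcastc : (C : ℝ) * ((2 : ℝ) ^ (T.card * k) * (n : ℝ) ^ (T.card - 1)) = (N : ℝ) := by
    rw [← mul_assoc]
    exact_mod_cast hcount
  have h2 : ((1 / 2 : ℝ) ^ k) ^ T.card = 1 / (2 : ℝ) ^ (T.card * k) := by
    rw [← pow_mul, one_div_pow, mul_comm]
  have h3 : (1 / (n : ℝ)) ^ (T.card - 1) = 1 / (n : ℝ) ^ (T.card - 1) := one_div_pow _ _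
  have ha : (2 : ℝ) ^ (T.card * k) ≠ 0 := pow_ne_zero _ two_ne_zero
  have hb : (n : ℝ) ^ (T.card - 1) ≠ 0 := pow_ne_zero _ hn1
  rw [hwt, h2, h3, ← hcastc]
  field_simp

/-- **The mean number of violated clauses after `L` rounds of monotone repair.** With `4k·m ≤ 2^k·n`,
`n ≥ 1`, `k ≥ 1` and `L ≥ 1`:
`∑_Φ #{c violated at round L} ≤ #Inst · m·2^{-k}·(2^{-L} + (2m 2^{-k}/n)^k)
  + ∑_{ℓ ≤ 2L} m^{ℓ+1} k^{ℓ+1} k^{ℓ+1} ((ℓ+1)k) · #Inst / n^{ℓ+1}`. -/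
theorem sissR_sum_card_violated_le (asm : Fin m → ℕ → (Fin k → Option (Finset (List (Fin k) × (Fin m × ℕ)))) → Finset (List (Fin k) × (Fin m × ℕ)))
    (hasm : ∀ (c : Fin m) (r : ℕ) (ch : Fin k → Option (Finset (List (Fin k) × (Fin m × ℕ))))
      (e : (List (Fin k) × (Fin m × ℕ))), e ∈ asm c r ch ↔ (e = ([], (c, r)) ∨
      ∃ (j : Fin k) (S : Finset (List (Fin k) × (Fin m × ℕ))), ch j = some S ∧
        ∃ b : List (Fin k), (b, e.2) ∈ S ∧ e.1 = b ++ [j]))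
    (TS : ℕ → Finset (Finset (List (Fin k) × (Fin m × ℕ)))) (L : ℕ)
    (hTS0 : ∀ T : Finset (List (Fin k) × (Fin m × ℕ)), T ∈ TS 0 ↔
      ∃ (c : Fin m) (r : ℕ), r ≤ L ∧ T = asm c r (fun _ => none))
    (hTSs : ∀ (d : ℕ) (T : Finset (List (Fin k) × (Fin m × ℕ))), T ∈ TS (d + 1) ↔
      ∃ (c : Fin m) (r : ℕ), r ≤ L ∧ ∃ ch : Fin k → Option (Finset (List (Fin k) × (Fin m × ℕ))),
        (∀ (j : Fin k) (S : Finset (List (Fin k) × (Fin m × ℕ))), ch j = some S → S ∈ TS d) ∧ T = asm c r ch)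
    (val : ℕ → (Fin m → Fin k → Fin n × Bool) → Fin n → Bool)
    (hval0 : ∀ (Φ : (Fin m → Fin k → Fin n × Bool)) (v : Fin n), val 0 Φ v = true)
    (hvalS : ∀ (t : ℕ) (Φ : (Fin m → Fin k → Fin n × Bool)) (v : Fin n), val (t + 1) Φ v = true ↔
      (val t Φ v = true ∧ ¬ (∃ ii : Fin m, (∀ jj : Fin k, val t Φ (Φ ii jj).1 ≠ (Φ ii jj).2) ∧
        ∃ jf : Fin k, (Φ ii jf).2 = false ∧ (∀ j' : Fin k, j' < jf → (Φ ii j').2 = true) ∧ (Φ ii jf).1 = v)))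
    (hk : 1 ≤ k) (hn : 1 ≤ n) (hα : (m : ℝ) * (4 * k) ≤ (n : ℝ) * 2 ^ k) (hL : 1 ≤ L) :
    (∑ Φ : (Fin m → Fin k → Fin n × Bool), ((((univ : Finset (Fin m)).filter fun c => (∀ jj : Fin k, val L Φ (Φ c jj).1 ≠ (Φ c jj).2)).card : ℕ) : ℝ))
      ≤ (Fintype.card (Fin m → Fin k → Fin n × Bool) : ℝ) * ((m : ℝ) * (1 / 2 : ℝ) ^ k *
          ((1 / 2 : ℝ) ^ L + (2 * ((m : ℝ) * (1 / 2 : ℝ) ^ k / n)) ^ k)) +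
        ∑ Lw ∈ Finset.range (2 * L + 1),
          ((m : ℝ) ^ (Lw + 1) * (k : ℝ) ^ (Lw + 1) * (k : ℝ) ^ (Lw + 1) * (((Lw : ℝ) + 1) * k) *
            (Fintype.card (Fin m → Fin k → Fin n × Bool) : ℝ)) / (n : ℝ) ^ (Lw + 1) := by
  have hn0 : (0 : ℝ) < n := by exact_mod_cast hn
  set G : Finset (Finset (List (Fin k) × (Fin m × ℕ))) := (TS L).filter (fun T => ((∀ e ∈ T, ∀ (j : Fin k) (y : Fin m) (s : ℕ), (j :: e.1, (y, s)) ∈ T →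
        s < e.2.2 ∧ ∃ j' : Fin k, ∀ lab : Fin m × ℕ, (j' :: j :: e.1, lab) ∉ T) ∧
      (∀ e ∈ T, 1 ≤ e.2.2 → (∃ (j : Fin k) (y : Fin m), (j :: e.1, (y, e.2.2 - 1)) ∈ T) ∨
        (e.1 = [] ∧ ∀ j : Fin k, ∃ lab : Fin m × ℕ, ([j], lab) ∈ T))) ∧ (∀ e ∈ T, ∀ e' ∈ T, e.2.1 = e'.2.1 → e.1 = e'.1) ∧
      ∃ y : Fin m, (([] : List (Fin k)), (y, L)) ∈ T) with hG
  -- per instance, then swap the sums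
  refine (Finset.sum_le_sum fun Φ _ =>
    sissR_card_viol_le asm hasm TS L hTS0 hTSs val hval0 hvalS hk Φ).trans ?_
  rw [Finset.sum_add_distrib]
  refine add_le_add ?_ ?_
  · -- the tree part
    rw [Finset.sum_comm]
    have hT : ∀ T ∈ G, ∑ Φ : (Fin m → Fin k → Fin n × Bool), (if (∀ e ∈ T, ∀ j : Fin k,
      (((Φ e.2.1 j).2 = true ↔ ∃ lab : Fin m × ℕ, (j :: e.1, lab) ∈ T) ∧
      ∀ (y : Fin m) (s : ℕ), (j :: e.1, (y, s)) ∈ T → ∃ j' : Fin k,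
        (∀ lab : Fin m × ℕ, (j' :: j :: e.1, lab) ∉ T) ∧
        (∀ j'' : Fin k, j'' < j' → ∃ lab : Fin m × ℕ, (j'' :: j :: e.1, lab) ∈ T) ∧
        (Φ e.2.1 j).1 = (Φ y j').1)) then (1 : ℝ) else 0)
        = (Fintype.card (Fin m → Fin k → Fin n × Bool) : ℝ) * (∏ e ∈ T, ((1 / 2 : ℝ) ^ k * (if e.1 = [] then (1 : ℝ) else 1 / (n : ℝ)))) := by
      intro T hT
      rw [hG, Finset.mem_filter] at hT
      rw [Finset.sum_boole]
      exact sissR_count_eq_wt asm hasm TS L hTS0 hTSs hn L T hT.1 hT.2.1 hT.2.2.1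
    rw [Finset.sum_congr rfl hT, ← Finset.mul_sum]
    refine mul_le_mul_of_nonneg_left ?_ (Nat.cast_nonneg _)
    have hsub : G ⊆ (TS (L - 1 + 1)).filter (fun T => ((∀ e ∈ T, ∀ (j : Fin k) (y : Fin m) (s : ℕ), (j :: e.1, (y, s)) ∈ T →
        s < e.2.2 ∧ ∃ j' : Fin k, ∀ lab : Fin m × ℕ, (j' :: j :: e.1, lab) ∉ T) ∧
      (∀ e ∈ T, 1 ≤ e.2.2 → (∃ (j : Fin k) (y : Fin m), (j :: e.1, (y, e.2.2 - 1)) ∈ T) ∨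
        (e.1 = [] ∧ ∀ j : Fin k, ∃ lab : Fin m × ℕ, ([j], lab) ∈ T))) ∧
        ∃ y : Fin m, (([] : List (Fin k)), (y, L)) ∈ T) := by
      intro T hT
      rw [hG, Finset.mem_filter] at hT
      rw [Finset.mem_filter, Nat.sub_add_cancel hL]
      exact ⟨hT.1, hT.2.1, hT.2.2.2⟩
    refine (Finset.sum_le_sum_of_subset_of_nonneg hsub fun T _ _ => sissR_wt_nonneg T).trans ?_
    exact sissR_weight_root asm hasm TS L hTS0 hTSs hk hn hα (L - 1) L hL
  · -- the bad part
    rw [Finset.sum_comm]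
    refine Finset.sum_le_sum fun Lw _ => ?_
    have h1 : (∑ Φ : (Fin m → Fin k → Fin n × Bool), ((((univ : Finset (Fin m)).filter fun c => (∃ (w : ℕ → Fin m) (u o : ℕ → Fin k) (a : ℕ) (j : Fin k),
        w 0 = c ∧ a ≤ Lw ∧ (∀ a' b', a' ≤ Lw → b' ≤ Lw → w a' = w b' → a' = b') ∧
        (∀ d, d < Lw → (Φ (w (d + 1)) (u (d + 1))).1 = (Φ (w d) (o d)).1) ∧
        (Lw = 0 ∨ o Lw ≠ u Lw) ∧ (a < Lw ∨ j ≠ o Lw) ∧ (Φ (w Lw) (o Lw)).1 = (Φ (w a) j).1)).card : ℕ) : ℝ))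
        ≤ ∑ Φ : (Fin m → Fin k → Fin n × Bool), (((((univ : Finset ((Fin (Lw + 1) → Fin m) × (Fin (Lw + 1) → Fin k) × (Fin (Lw + 1) → Fin k) ×
        Fin (Lw + 1) × Fin k)).filter fun p =>
          (∀ a b, a ≤ Lw → b ≤ Lw → (fun e : ℕ => if h : e ≤ Lw then p.1 ⟨e, Nat.lt_succ_of_le h⟩ else p.1 0) a = (fun e : ℕ => if h : e ≤ Lw then p.1 ⟨e, Nat.lt_succ_of_le h⟩ else p.1 0) b → a = b) ∧
          (∀ d, d < Lw → (Φ ((fun e : ℕ => if h : e ≤ Lw then p.1 ⟨e, Nat.lt_succ_of_le h⟩ else p.1 0) (d + 1)) ((fun e : ℕ => if h : e ≤ Lw then p.2.1 ⟨e, Nat.lt_succ_of_le h⟩ else p.2.1 0) (d + 1))).1 =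
            (Φ ((fun e : ℕ => if h : e ≤ Lw then p.1 ⟨e, Nat.lt_succ_of_le h⟩ else p.1 0) d) ((fun e : ℕ => if h : e ≤ Lw then p.2.2.1 ⟨e, Nat.lt_succ_of_le h⟩ else p.2.2.1 0) d)).1) ∧
          (Lw = 0 ∨ (fun e : ℕ => if h : e ≤ Lw then p.2.2.1 ⟨e, Nat.lt_succ_of_le h⟩ else p.2.2.1 0) Lw ≠ (fun e : ℕ => if h : e ≤ Lw then p.2.1 ⟨e, Nat.lt_succ_of_le h⟩ else p.2.1 0) Lw) ∧
          ((p.2.2.2.1 : ℕ) < Lw ∨ p.2.2.2.2 ≠ (fun e : ℕ => if h : e ≤ Lw then p.2.2.1 ⟨e, Nat.lt_succ_of_le h⟩ else p.2.2.1 0) Lw) ∧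
          (Φ ((fun e : ℕ => if h : e ≤ Lw then p.1 ⟨e, Nat.lt_succ_of_le h⟩ else p.1 0) Lw) ((fun e : ℕ => if h : e ≤ Lw then p.2.2.1 ⟨e, Nat.lt_succ_of_le h⟩ else p.2.2.1 0) Lw)).1 = (Φ ((fun e : ℕ => if h : e ≤ Lw then p.1 ⟨e, Nat.lt_succ_of_le h⟩ else p.1 0) p.2.2.2.1) p.2.2.2.2).1)).card : ℕ) : ℝ) := by
      refine Finset.sum_le_sum fun Φ _ => ?_
      exact_mod_cast sissR_card_badStart_le Φ Lw
    refine h1.trans ?_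
    have h2 := sissR_sum_card_badData_mul_le (m := m) (k := k) (n := n) Lw
    have h2' : (∑ Φ : (Fin m → Fin k → Fin n × Bool), (((((univ : Finset ((Fin (Lw + 1) → Fin m) × (Fin (Lw + 1) → Fin k) × (Fin (Lw + 1) → Fin k) ×
        Fin (Lw + 1) × Fin k)).filter fun p =>
          (∀ a b, a ≤ Lw → b ≤ Lw → (fun e : ℕ => if h : e ≤ Lw then p.1 ⟨e, Nat.lt_succ_of_le h⟩ else p.1 0) a = (fun e : ℕ => if h : e ≤ Lw then p.1 ⟨e, Nat.lt_succ_of_le h⟩ else p.1 0) b → a = b) ∧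
          (∀ d, d < Lw → (Φ ((fun e : ℕ => if h : e ≤ Lw then p.1 ⟨e, Nat.lt_succ_of_le h⟩ else p.1 0) (d + 1)) ((fun e : ℕ => if h : e ≤ Lw then p.2.1 ⟨e, Nat.lt_succ_of_le h⟩ else p.2.1 0) (d + 1))).1 =
            (Φ ((fun e : ℕ => if h : e ≤ Lw then p.1 ⟨e, Nat.lt_succ_of_le h⟩ else p.1 0) d) ((fun e : ℕ => if h : e ≤ Lw then p.2.2.1 ⟨e, Nat.lt_succ_of_le h⟩ else p.2.2.1 0) d)).1) ∧
          (Lw = 0 ∨ (fun e : ℕ => if h : e ≤ Lw then p.2.2.1 ⟨e, Nat.lt_succ_of_le h⟩ else p.2.2.1 0) Lw ≠ (fun e : ℕ => if h : e ≤ Lw then p.2.1 ⟨e, Nat.lt_succ_of_le h⟩ else p.2.1 0) Lw) ∧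
          ((p.2.2.2.1 : ℕ) < Lw ∨ p.2.2.2.2 ≠ (fun e : ℕ => if h : e ≤ Lw then p.2.2.1 ⟨e, Nat.lt_succ_of_le h⟩ else p.2.2.1 0) Lw) ∧
          (Φ ((fun e : ℕ => if h : e ≤ Lw then p.1 ⟨e, Nat.lt_succ_of_le h⟩ else p.1 0) Lw) ((fun e : ℕ => if h : e ≤ Lw then p.2.2.1 ⟨e, Nat.lt_succ_of_le h⟩ else p.2.2.1 0) Lw)).1 = (Φ ((fun e : ℕ => if h : e ≤ Lw then p.1 ⟨e, Nat.lt_succ_of_le h⟩ else p.1 0) p.2.2.2.1) p.2.2.2.2).1)).card : ℕ) : ℝ)) * (n : ℝ) ^ (Lw + 1)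
        ≤ (m : ℝ) ^ (Lw + 1) * (k : ℝ) ^ (Lw + 1) * (k : ℝ) ^ (Lw + 1) * (((Lw : ℝ) + 1) * k) *
            (Fintype.card (Fin m → Fin k → Fin n × Bool) : ℝ) := by
      exact_mod_cast h2
    rw [le_div_iff₀ (by positivity)]
    exact h2'

end Mean

end Summit.PneNP.PneNP.Theorems
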